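import Mathlib
import Summits.Ventures.HodgeRepro.Tier4.Common.AdicResidue

/-!
# Tier4/Line4/NonsplitLocal — the norm-one curve `x² + d y² = 1` of a NON-SPLIT quadratic datum is BOUNDED over a locally
compact field (the local half of C-L4-NONSPLIT-FINITE)

Blind re-derivation cell `pub-hodge-repro`, Tier 4 «prove the step» (README §9–§10), seat t4-L1-p2 (prover, LINE L1, gen 5;
L4 service cut C-L4-NONSPLIT-FINITE, plan-4 g6 S15721, TAKEN S15722).  Tree path
`lean/Summits/Ventures/HodgeRepro/Tier4/Line4/NonsplitLocal.lean`.  Mathlib + typer-2's `Common/AdicResidue`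
(`properSpace_adicCompletion`); no literature.

THE MATHEMATICS.  Over a field `K`, if `−d` is not a square then the binary form `Q(x, y) = x² + d y²` is ANISOTROPIC
(`Q(x, y) = 0 ⇒ y = 0 ⇒ x = 0`, since otherwise `−d = (x/y)²`).  Over a PROPER normed field (every closed ball compact —
`K = k_v` for a finite place `v` of a number field, AdicResidue) anisotropy gives a uniform lower bound `c > 0` for `‖Q‖` on the
compact "sphere" `{max ‖x‖ ‖y‖ = 1}`, and homogeneity `Q(x/λ, y/λ) = Q(x, y)/λ²` with `‖λ‖ = max ‖x‖ ‖y‖` turns `Q(x, y) = 1`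
into `max ‖x‖ ‖y‖ ≤ max 1 c⁻¹`: **the norm-one curve is bounded** (`exists_norm_le_of_sq_add_mul_sq_eq_one`).  At a SPLIT place
(`−d = e²`) the curve contains `(x, (x − 1)/e)`-type unbounded families — the hypothesis is load-bearing (ruling (E1) S15715,
crit-2 Entry 338).  At a place `v ∣ p` the bound becomes `‖p^m x‖ ≤ 1`, i.e. `p^m x ∈ 𝓞_v`, for a fixed `m` (`‖p‖_v < 1`):
`exists_pow_mul_mem_adicCompletionIntegers_of_sq_add_mul_sq_eq_one`, the shape the adelic module consumes.

* `eq_zero_of_sq_add_mul_sq_eq_zero` — anisotropy from `¬ IsSquare (−d)` (any field of characteristic `≠ 2` is not needed: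
  the argument divides by `y` only).
* `isCompact_sphereMax` — `{p : K × K | max ‖p.1‖ ‖p.2‖ = 1}` is compact in a proper normed field.
* `exists_pos_le_norm_sq_add_mul_sq_of_sphere` — the positive lower bound of `‖Q‖` on the sphere.
* **`exists_norm_le_of_sq_add_mul_sq_eq_one`** — `∃ R, ∀ x y, x² + d y² = 1 → ‖x‖ ≤ R ∧ ‖y‖ ≤ R`.
* **`exists_pow_mul_mem_adicCompletionIntegers_of_sq_add_mul_sq_eq_one`** — at `v` with `‖p‖_v < 1`: `∃ m, ∀ x y, x² + d y² = 1 →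
  p^m x ∈ 𝓞_v ∧ p^m y ∈ 𝓞_v`.

Nothing here says anything about the status of the Hodge conjecture for CM abelian varieties, which is NOT proved
(HC_CM is NOT proved by anyone in this repository).
-/

set_option autoImplicit false

noncomputable section

namespace Summit.Ventures.HodgeRepro.Tier4.Line4

open Summit.Ventures.HodgeRepro.Tier4.Common NumberField IsDedekindDomain

/-! ## Part A — anisotropy and the bound over a proper normed field -/

section Anisotropic

variable {K : Type*} [NormedField K]

/-- **Anisotropy**: if `−d` is not a square, `x² + d y² = 0` forces `x = y = 0`. -/
theorem eq_zero_of_sq_add_mul_sq_eq_zero {d : K} (hd : ¬ IsSquare (-d)) {x y : K} (h : x ^ 2 + d * y ^ 2 = 0) :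
    x = 0 ∧ y = 0 := by
  by_cases hy : y = 0
  · subst hy
    refine ⟨?_, rfl⟩
    have : x ^ 2 = 0 := by simpa using h
    exact pow_eq_zero_iff (n := 2) (by norm_num) |>.1 this
  · exfalso
    apply hd
    refine ⟨x / y, ?_⟩
    have hy2 : y ^ 2 ≠ 0 := pow_ne_zero 2 hy
    field_simp
    linear_combination -h

/-- The form `Q(x, y) = x² + d y²` as a function on pairs. -/
def quadForm (d : K) (p : K × K) : K := p.1 ^ 2 + d * p.2 ^ 2

/-- `Q` is continuous. -/
theorem continuous_quadForm (d : K) : Continuous (quadForm d) :=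
  (continuous_fst.pow 2).add (continuous_const.mul (continuous_snd.pow 2))

/-- The "sphere" `max ‖x‖ ‖y‖ = 1` of `K × K`. -/
def sphereMax (K : Type*) [NormedField K] : Set (K × K) := {p | max ‖p.1‖ ‖p.2‖ = 1}

/-- The sphere is closed. -/
theorem isClosed_sphereMax : IsClosed (sphereMax K) :=
  isClosed_eq ((continuous_fst.norm).max (continuous_snd.norm)) continuous_const

/-- The sphere is bounded (it lies in the closed unit ball of the product). -/
theorem sphereMax_subset_closedBall : sphereMax K ⊆ Metric.closedBall (0 : K × K) 1 := by
  intro p hp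
  rw [Metric.mem_closedBall, dist_zero_right, Prod.norm_def]
  exact le_of_eq hp

/-- **The sphere is compact** in a proper normed field. -/
theorem isCompact_sphereMax [ProperSpace K] : IsCompact (sphereMax K) :=
  (isCompact_closedBall (0 : K × K) 1).of_isClosed_subset isClosed_sphereMax sphereMax_subset_closedBall

/-- The sphere is non-empty: `(1, 0)`. -/
theorem one_zero_mem_sphereMax : ((1 : K), (0 : K)) ∈ sphereMax K := by
  simp [sphereMax]

/-- **The positive lower bound of `‖Q‖` on the sphere** (compactness + anisotropy). -/
theorem exists_pos_le_norm_sq_add_mul_sq_of_sphere [ProperSpace K] {d : K} (hd : ¬ IsSquare (-d)) :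
    ∃ c : ℝ, 0 < c ∧ ∀ x y : K, max ‖x‖ ‖y‖ = 1 → c ≤ ‖x ^ 2 + d * y ^ 2‖ := by
  obtain ⟨p₀, hp₀, hmin⟩ := (isCompact_sphereMax (K := K)).exists_isMinOn ⟨_, one_zero_mem_sphereMax⟩
    ((continuous_quadForm d).norm.continuousOn)
  refine ⟨‖quadForm d p₀‖, ?_, fun x y hxy => hmin (show (x, y) ∈ sphereMax K from hxy)⟩
  rw [norm_pos_iff]
  intro h0
  obtain ⟨h1, h2⟩ := eq_zero_of_sq_add_mul_sq_eq_zero hd h0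
  have : max ‖p₀.1‖ ‖p₀.2‖ = 1 := hp₀
  rw [h1, h2] at this
  simp at this

/-- **THE BOUND**: on a proper normed field, if `−d` is not a square then the norm-one curve `x² + d y² = 1` is bounded. -/
theorem exists_norm_le_of_sq_add_mul_sq_eq_one [ProperSpace K] {d : K} (hd : ¬ IsSquare (-d)) :
    ∃ R : ℝ, 0 < R ∧ ∀ x y : K, x ^ 2 + d * y ^ 2 = 1 → ‖x‖ ≤ R ∧ ‖y‖ ≤ R := by
  obtain ⟨c, hc, hsph⟩ := exists_pos_le_norm_sq_add_mul_sq_of_sphere hd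
  refine ⟨max 1 c⁻¹, lt_max_of_lt_left one_pos, fun x y hxy => ?_⟩
  -- the scaling argument: `λ ∈ {x, y}` of maximal norm
  have key : ∀ lam : K, lam ≠ 0 → ‖lam‖ = max ‖x‖ ‖y‖ → max ‖x‖ ‖y‖ ≤ max 1 c⁻¹ := by
    intro lam hlam hlamn
    have hsph' : max ‖x / lam‖ ‖y / lam‖ = 1 := by
      rw [norm_div, norm_div, max_div_div_right (norm_nonneg lam), ← hlamn]
      exact div_self (norm_ne_zero_iff.2 hlam)
    have hQ : (x / lam) ^ 2 + d * (y / lam) ^ 2 = 1 / lam ^ 2 := by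
      field_simp
      linear_combination hxy
    have hle := hsph _ _ hsph'
    rw [hQ, norm_div, norm_one, norm_pow] at hle
    -- `c ≤ 1 / ‖lam‖²`, so `‖lam‖² ≤ c⁻¹`
    have hlampos : 0 < ‖lam‖ := norm_pos_iff.2 hlam
    have h2 : ‖lam‖ ^ 2 ≤ c⁻¹ := by
      have h3 : c * ‖lam‖ ^ 2 ≤ 1 := (le_div_iff₀ (by positivity)).1 hle
      calc ‖lam‖ ^ 2 = c⁻¹ * (c * ‖lam‖ ^ 2) := by field_simp
        _ ≤ c⁻¹ * 1 := by gcongr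
        _ = c⁻¹ := mul_one _
    rw [← hlamn]
    by_cases h1 : ‖lam‖ ≤ 1
    · exact h1.trans (le_max_left _ _)
    · rw [not_le] at h1
      have : ‖lam‖ ≤ ‖lam‖ ^ 2 := by nlinarith
      exact this.trans (h2.trans (le_max_right _ _))
  have hne : ¬ (x = 0 ∧ y = 0) := by
    rintro ⟨rfl, rfl⟩
    simp at hxy
  by_cases hyx : ‖y‖ ≤ ‖x‖
  · have hx0 : x ≠ 0 := by
      intro hx
      apply hne
      refine ⟨hx, ?_⟩
      rw [hx, norm_zero] at hyx
      exact norm_le_zero_iff.1 hyx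
    have hm := key x hx0 (max_eq_left hyx).symm
    exact ⟨(le_max_left _ _).trans hm, (le_max_right _ _).trans hm⟩
  · rw [not_le] at hyx
    have hy0 : y ≠ 0 := by
      intro hy
      rw [hy, norm_zero] at hyx
      exact absurd hyx (not_lt.2 (norm_nonneg x))
    have hm := key y hy0 (max_eq_right hyx.le).symm
    exact ⟨(le_max_left _ _).trans hm, (le_max_right _ _).trans hm⟩

end Anisotropic

/-! ## Part B — at a finite place `v ∣ p`: the bound in the integral form `p^m x ∈ 𝓞_v` -/

section Adic

variable {k : Type} [Field k] [NumberField k] (v : HeightOneSpectrum (𝓞 k))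

/-- **The bound at `v`, integral form**: for `‖p‖_v < 1` and `−d` not a square in `k_v`, there is `m` with `p^m x, p^m y ∈ 𝓞_v`
for every `(x, y)` on the norm-one curve. -/
theorem exists_pow_mul_mem_adicCompletionIntegers_of_sq_add_mul_sq_eq_one {d : v.adicCompletion k}
    (hd : ¬ IsSquare (-d)) {p : ℕ} (hp : ‖((p : k) : v.adicCompletion k)‖ < 1) :
    ∃ m : ℕ, ∀ x y : v.adicCompletion k, x ^ 2 + d * y ^ 2 = 1 →
      ((p : k) : v.adicCompletion k) ^ m * x ∈ v.adicCompletionIntegers k ∧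
        ((p : k) : v.adicCompletion k) ^ m * y ∈ v.adicCompletionIntegers k := by
  haveI : ProperSpace (v.adicCompletion k) := properSpace_adicCompletion k v
  obtain ⟨R, hR, hbound⟩ := exists_norm_le_of_sq_add_mul_sq_eq_one hd
  obtain ⟨m, hm⟩ := exists_pow_lt_of_lt_one (inv_pos.2 hR) hp
  refine ⟨m, fun x y hxy => ?_⟩
  obtain ⟨hx, hy⟩ := hbound x y hxy
  have hpm : 0 ≤ ‖((p : k) : v.adicCompletion k)‖ ^ m := by positivity
  have key : ∀ z : v.adicCompletion k, ‖z‖ ≤ R → ((p : k) : v.adicCompletion k) ^ m * z ∈ v.adicCompletionIntegers k := by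
    intro z hz
    rw [HeightOneSpectrum.mem_adicCompletionIntegers, ← Valued.toNormedField.norm_le_one_iff, norm_mul, norm_pow]
    calc ‖((p : k) : v.adicCompletion k)‖ ^ m * ‖z‖ ≤ R⁻¹ * R := by
          gcongr
        _ = 1 := inv_mul_cancel₀ hR.ne'
  exact ⟨key x hx, key y hy⟩

end Adic

end Summit.Ventures.HodgeRepro.Tier4.Line4

end
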